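import Literature.NumberTheory.LFunctions.PadicMultivariateHensel
import Literature.NumberTheory.LFunctions.WooleyEliminant
import Mathlib.Algebra.MvPolynomial.Funext
import Mathlib.LinearAlgebra.Matrix.Block
import Mathlib.Algebra.Polynomial.Roots
import Mathlib.RingTheory.MvPolynomial.Tower
import HarnessLib

/-!
# Wooley's theorem on simultaneous congruences

Topic `Literature/NumberTheory/LFunctions` (an input of Ford's bounds for Vinogradov's integral,
Ford 2002 Lemma 2.4). Everything here is PROVED.

**Theorem (Wooley 1996, Thm. 1).** Let `F₁,…,F_d ∈ ℤ[x₁,…,x_d]` have total degrees `k₁,…,k_d`, let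
`p` be prime and `s ≥ 1`. Then the number of solutions `x (mod pˢ)` of `Fⱼ(x) ≡ 0 (mod pˢ)`
(`1 ≤ j ≤ d`) with `p ∤ det(∂Fⱼ/∂xᵢ)(x)` is at most `k₁⋯k_d` (`Wooley.card_solutions_le`, stated
for a finset of pairwise-incongruent integer representatives).

The proof is Wooley's elementary one: Hensel lifts to exact zeros in `ℤ_pᵈ`
(`Wooley.hensel_mv`), a `p`-adically weighted change of the first variable which separates the
first coordinates of the (finitely many) zeros modulo `p^{2dU}` (`Wooley.tsep_separates`), the
eliminant `Ψ(x₁, H) = 0` of `y₁`-degree `≤ ∏ kⱼ` (`Wooley.exists_eliminant`), a deformation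
`H ↦ H − p^{2dU}a` making the specialised eliminant a nonzero univariate polynomial, and root
counting in the field `ℚ_p`.

## References

* T. D. Wooley, *A note on simultaneous congruences*, J. Number Theory 58 (1996), 288–297,
  Theorem 1 and §2. [Wooley1996]
* K. Ford, *Vinogradov's integral and bounds for the Riemann zeta function*, Proc. LMS 85 (2002),
  Lemma 2.4. [Ford2002]
-/

noncomputable section

open MvPolynomial

namespace Literature.NumberTheory.LFunctions
namespace Wooley

variable {p : ℕ} [Fact p.Prime]

/-! ## `p`-adic helpers -/

/-- A `p`-adic integer congruent to a unit modulo `pˢ` (`s ≥ 1`) is a unit. [folklore] -/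
theorem isUnit_of_sub_mem_span {u v : ℤ_[p]} (hv : IsUnit v) {s : ℕ} (hs : 1 ≤ s)
    (h : u - v ∈ (Ideal.span {(p : ℤ_[p]) ^ s} : Ideal ℤ_[p])) : IsUnit u := by
  rw [PadicInt.isUnit_iff] at hv ⊢
  have hp1 : (1 : ℝ) < p := by exact_mod_cast (Fact.out : p.Prime).one_lt
  have h1 : ‖u - v‖ < 1 := by
    have := (mem_span_pow_iff_norm _ _).1 h
    refine lt_of_le_of_lt this ?_
    rw [zpow_neg, zpow_natCast]
    exact inv_lt_one_of_one_lt₀ (one_lt_pow₀ hp1 (by omega))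
  refine le_antisymm (PadicInt.norm_le_one _) ?_
  by_contra hlt
  push Not at hlt
  have : ‖v‖ ≤ max ‖u‖ ‖-(u - v)‖ := by
    have := PadicInt.nonarchimedean u (-(u - v))
    rwa [show u + -(u - v) = v by ring] at this
  rw [norm_neg, hv] at this
  rcases le_max_iff.1 this with h' | h' <;> linarith

/-- Integers: `(k : ℤ_p) ∈ (pˢ) ↔ pˢ ∣ k`. [folklore] -/
theorem intCast_mem_span_pow_iff {k : ℤ} {s : ℕ} :
    (k : ℤ_[p]) ∈ (Ideal.span {(p : ℤ_[p]) ^ s} : Ideal ℤ_[p]) ↔ (p : ℤ) ^ s ∣ k := by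
  rw [mem_span_pow_iff_norm, PadicInt.norm_int_le_pow_iff_dvd]

/-- An integer not divisible by `p` is a `p`-adic unit. [folklore] -/
theorem isUnit_intCast_of_not_dvd {k : ℤ} (h : ¬ (p : ℤ) ∣ k) : IsUnit (k : ℤ_[p]) := by
  rw [PadicInt.isUnit_iff]
  refine le_antisymm (PadicInt.norm_le_one _) ?_
  by_contra hlt
  push Not at hlt
  exact h ((PadicInt.norm_int_lt_one_iff_dvd k).1 hlt)

/-- Cancelling a power of `p` in a congruence: `pᵃ c ∈ (p^{a+b}) ⟹ c ∈ (pᵇ)`. [folklore] -/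
theorem mem_span_pow_of_pow_mul_mem {c : ℤ_[p]} {a b : ℕ}
    (h : (p : ℤ_[p]) ^ a * c ∈ (Ideal.span {(p : ℤ_[p]) ^ (a + b)} : Ideal ℤ_[p])) :
    c ∈ (Ideal.span {(p : ℤ_[p]) ^ b} : Ideal ℤ_[p]) := by
  rw [Ideal.mem_span_singleton] at h ⊢
  obtain ⟨e, he⟩ := h
  refine ⟨e, ?_⟩
  have hp0 : (p : ℤ_[p]) ^ a ≠ 0 := pow_ne_zero _ (by exact_mod_cast (Fact.out : p.Prime).ne_zero)
  apply mul_left_cancel₀ hp0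
  rw [he]; ring

/-! ## Separation of the first coordinate -/

/-- The weighted sum `T(z) = ∑ₗ p^{2lU} zₗ`. [cite: Wooley1996, Theorem 1 (proof)] -/
def tsep (U : ℕ) {n : ℕ} (z : Fin n → ℤ_[p]) : ℤ_[p] :=
  ∑ l : Fin n, (p : ℤ_[p]) ^ (2 * l.val * U) * z l

/-- Recursion for `tsep`. [folklore] -/
theorem tsep_succ (U : ℕ) {n : ℕ} (z : Fin (n + 1) → ℤ_[p]) :
    tsep U z = z 0 + (p : ℤ_[p]) ^ (2 * U) * tsep U (Fin.tail z) := by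
  simp only [tsep, Fin.sum_univ_succ, Fin.val_zero, mul_zero, zero_mul, pow_zero, one_mul,
    Finset.mul_sum, Fin.tail]
  congr 1
  refine Finset.sum_congr rfl fun l _ ↦ ?_
  rw [← mul_assoc, ← pow_add]
  congr 2
  simp only [Fin.val_succ]; ring

/-- **Separation.** If the coordinates of `y ≠ y'` are either equal or incongruent modulo `p^U`,
then `T(y) ≢ T(y') (mod p^{2nU})`. [cite: Wooley1996, Theorem 1 (proof, (8))] -/
theorem tsep_separates (U : ℕ) : ∀ {n : ℕ} (y y' : Fin n → ℤ_[p]),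
    (∀ i, y i = y' i ∨ y i - y' i ∉ (Ideal.span {(p : ℤ_[p]) ^ U} : Ideal ℤ_[p])) →
    tsep U y - tsep U y' ∈ (Ideal.span {(p : ℤ_[p]) ^ (2 * n * U)} : Ideal ℤ_[p]) → y = y'
  | 0, y, y', _, _ => funext fun i ↦ Fin.elim0 i
  | n + 1, y, y', hsep, hT => by
    have e : tsep U y - tsep U y' = (y 0 - y' 0)
        + (p : ℤ_[p]) ^ (2 * U) * (tsep U (Fin.tail y) - tsep U (Fin.tail y')) := by
      rw [tsep_succ, tsep_succ]; ring
    set I : ℕ → Ideal ℤ_[p] := fun m ↦ Ideal.span {(p : ℤ_[p]) ^ m} with hI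
    have hIle : ∀ {a b : ℕ}, a ≤ b → I b ≤ I a := fun {a b} hab ↦ by
      simp only [hI]
      exact Ideal.span_singleton_le_span_singleton.2 (pow_dvd_pow _ hab)
    -- the first coordinate
    have h0 : y 0 = y' 0 := by
      rcases hsep 0 with h | h
      · exact h
      · exfalso; apply h
        have h2 : (p : ℤ_[p]) ^ (2 * U) * (tsep U (Fin.tail y) - tsep U (Fin.tail y')) ∈ I U :=
          hIle (by omega) (Ideal.mul_mem_right _ _ (Ideal.mem_span_singleton_self _))
        have h3 : tsep U y - tsep U y' ∈ I U := hIle (by nlinarith) hT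
        rw [e] at h3
        have := (I U).sub_mem h3 h2
        rwa [add_sub_cancel_right] at this
    -- the tail, by induction
    have htail : Fin.tail y = Fin.tail y' := by
      refine tsep_separates U (Fin.tail y) (Fin.tail y') (fun i ↦ hsep i.succ) ?_
      rw [e, h0, sub_self, zero_add] at hT
      have : 2 * (n + 1) * U = 2 * U + 2 * n * U := by ring
      rw [this] at hT
      exact mem_span_pow_of_pow_mul_mem hT
    calc y = Fin.cons (y 0) (Fin.tail y) := (Fin.cons_self_tail y).symm
      _ = Fin.cons (y' 0) (Fin.tail y') := by rw [h0, htail]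
      _ = y' := Fin.cons_self_tail y'

/-! ## Lattice points avoiding a hypersurface -/

/-- A nonzero rational polynomial does not vanish at some point of the lattice `N ℤⁿ`.
[cite: Wooley1996, Lemma 1] -/
theorem exists_lattice_eval_ne_zero {n : ℕ} (q : MvPolynomial (Fin n) ℚ) (hq : q ≠ 0) (N : ℤ)
    (hN : N ≠ 0) : ∃ α : Fin n → ℤ, eval (fun i ↦ ((N * α i : ℤ) : ℚ)) q ≠ 0 := by
  by_contra hall
  push Not at hall
  apply hq
  refine MvPolynomial.funext_set (fun _ ↦ Set.range fun m : ℤ ↦ ((N * m : ℤ) : ℚ)) (fun _ ↦ ?_) ?_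
  · refine Set.infinite_range_of_injective fun a b h ↦ ?_
    have : (N * a : ℤ) = N * b := by exact_mod_cast h
    exact mul_left_cancel₀ hN this
  · intro x hx
    choose α hα using fun i ↦ (hx i (Set.mem_univ i))
    have : x = fun i ↦ ((N * α i : ℤ) : ℚ) := funext fun i ↦ (hα i).symm
    rw [this, map_zero]
    exact hall α

/-! ## Jacobian polynomials and evaluation -/

/-- The Jacobian matrix of polynomials `(∂ᵢ Gⱼ)`. [folklore] -/
def jacPoly {m : ℕ} {R : Type*} [CommRing R] (G : Fin m → MvPolynomial (Fin m) R) :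
    Matrix (Fin m) (Fin m) (MvPolynomial (Fin m) R) :=
  Matrix.of fun j i ↦ pderiv i (G j)

/-- `det (Jac G c) = (det jacPoly G)(c)`. [folklore] -/
theorem det_Jac_eq {m : ℕ} (G : Fin m → MvPolynomial (Fin m) ℤ) (c : Fin m → ℤ_[p]) :
    (Jac G c).det = aeval c (jacPoly G).det := by
  rw [AlgHom.map_det]
  rfl

/-- Evaluation at integer points, read in `ℤ_p`. [folklore] -/
theorem aeval_intCast {τ : Type*} (f : MvPolynomial τ ℤ) (x : τ → ℤ) :
    aeval (fun i ↦ (x i : ℤ_[p])) f = ((eval x f : ℤ) : ℤ_[p]) := by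
  have := ringHom_aeval (Int.castRingHom ℤ_[p]) x f
  simp only [eq_intCast] at this
  simpa using this.symm

/-- `eval (φ ∘ β) (map φ q) = φ (eval β q)`. [folklore] -/
theorem eval_map_comp {τ : Type*} {A B : Type*} [CommRing A] [CommRing B] (φ : A →+* B)
    (β : τ → A) (q : MvPolynomial τ A) : eval (fun i ↦ φ (β i)) (map φ q) = φ (eval β q) := by
  rw [MvPolynomial.eval_map, MvPolynomial.eval_eq, MvPolynomial.eval₂_eq]
  simp [map_sum, map_mul, map_prod, map_pow, MvPolynomial.coeff]

/-! ## The change of variables -/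

section Subst

variable {n : ℕ}

/-- `T⁺ = ∑_{l<n} p^{2(l+1)U} X_{l+1}` (the part of `T` beyond `X₀`). [cite: Wooley1996, Theorem 1 (proof)] -/
def tplus (p : ℕ) (U : ℕ) : MvPolynomial (Fin (n + 1)) ℤ :=
  ∑ l : Fin n, C ((p : ℤ) ^ (2 * (l.val + 1) * U)) * X l.succ

/-- The substitution `x₀ ↦ x₀ − T⁺`, `xᵢ ↦ xᵢ` (`i ≠ 0`). [cite: Wooley1996, Theorem 1 (proof)] -/
def subL (p : ℕ) (U : ℕ) : Fin (n + 1) → MvPolynomial (Fin (n + 1)) ℤ :=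
  fun i ↦ if i = 0 then X 0 - tplus p U else X i

/-- The corresponding map on points of `ℤ_p^{n+1}`. [cite: Wooley1996, Theorem 1 (proof)] -/
def vmap (U : ℕ) (z : Fin (n + 1) → ℤ_[p]) : Fin (n + 1) → ℤ_[p] :=
  Function.update z 0 (z 0 - (p : ℤ_[p]) ^ (2 * U) * tsep U (Fin.tail z))

/-- Its inverse: `z₀ = T(y)`, `zᵢ = yᵢ`. [cite: Wooley1996, Theorem 1 (proof)] -/
def vinv (U : ℕ) (y : Fin (n + 1) → ℤ_[p]) : Fin (n + 1) → ℤ_[p] :=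
  Function.update y 0 (tsep U y)

/-- Evaluation of `tplus`. [folklore] -/
theorem aeval_tplus (U : ℕ) (z : Fin (n + 1) → ℤ_[p]) :
    aeval z (tplus (n := n) p U) = (p : ℤ_[p]) ^ (2 * U) * tsep U (Fin.tail z) := by
  simp only [tplus, map_sum, map_mul, map_pow, map_natCast, aeval_X, tsep, Finset.mul_sum, Fin.tail]
  refine Finset.sum_congr rfl fun l _ ↦ ?_
  rw [← mul_assoc, ← pow_add]
  congr 2; ring

/-- Evaluation of the substitution `subL` is `vmap`. [folklore] -/
theorem aeval_subL (U : ℕ) (z : Fin (n + 1) → ℤ_[p]) (i : Fin (n + 1)) :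
    aeval z (subL (n := n) p U i) = vmap U z i := by
  simp only [subL, vmap]
  split_ifs with h
  · subst h
    rw [Function.update_self, map_sub, aeval_X, aeval_tplus]
  · rw [Function.update_of_ne h, aeval_X]

/-- `vinv` is a right inverse of `vmap`. [folklore] -/
theorem vmap_vinv (U : ℕ) (y : Fin (n + 1) → ℤ_[p]) : vmap U (vinv U y) = y := by
  funext i
  simp only [vmap, vinv]
  by_cases h : i = 0
  · subst h
    rw [Function.update_self, Function.update_self]
    have : Fin.tail (Function.update y 0 (tsep U y)) = Fin.tail y := by
      funext j; simp [Fin.tail]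
    rw [this, tsep_succ]; ring
  · rw [Function.update_of_ne h, Function.update_of_ne h]

/-- The `0`-th coordinate of `vinv`. [folklore] -/
theorem vinv_zero (U : ℕ) (y : Fin (n + 1) → ℤ_[p]) : vinv U y 0 = tsep U y := by
  simp [vinv]

omit [Fact p.Prime] in
/-- The substitution is affine-linear. [folklore] -/
theorem totalDegree_subL_le (U : ℕ) (i : Fin (n + 1)) : (subL (n := n) p U i).totalDegree ≤ 1 := by
  simp only [subL]
  split_ifs
  · refine (totalDegree_sub _ _).trans (max_le ?_ ?_)
    · exact (totalDegree_X (R := ℤ) (0 : Fin (n + 1))).le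
    · refine totalDegree_finsetSum_le fun l _ ↦ (totalDegree_mul _ _).trans ?_
      rw [totalDegree_C, zero_add]
      exact (totalDegree_X (R := ℤ) _).le
  · exact (totalDegree_X (R := ℤ) _).le

omit [Fact p.Prime] in
/-- The Jacobian of the substitution has determinant `1`, so
`det jacPoly (F ∘ L) = bind₁ L (det jacPoly F)`. [cite: Wooley1996, Theorem 1 (proof)] -/
theorem det_jacPoly_bind₁_subL (U : ℕ) (F : Fin (n + 1) → MvPolynomial (Fin (n + 1)) ℤ) :
    (jacPoly fun j ↦ bind₁ (subL p U) (F j)).det = bind₁ (subL (n := n) p U) (jacPoly F).det := by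
  classical
  set DL : Matrix (Fin (n + 1)) (Fin (n + 1)) (MvPolynomial (Fin (n + 1)) ℤ) :=
    Matrix.of fun i k ↦ pderiv k (subL (n := n) p U i) with hDL
  have hprod : (jacPoly fun j ↦ bind₁ (subL p U) (F j))
      = ((bind₁ (subL (n := n) p U)).mapMatrix (jacPoly F)) * DL := by
    ext j k
    simp only [jacPoly, Matrix.of_apply, Matrix.mul_apply, AlgHom.mapMatrix_apply, Matrix.map_apply,
      hDL]
    rw [pderiv_bind₁]
  have hpt : ∀ k : Fin (n + 1), pderiv k (tplus (n := n) p U)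
      = if h : k = 0 then 0 else C ((p : ℤ) ^ (2 * ((k.pred h).val + 1) * U)) := by
    intro k
    simp only [tplus, map_sum, Derivation.leibniz, pderiv_X, pderiv_C, smul_eq_mul]
    split_ifs with hk
    · subst hk
      refine Finset.sum_eq_zero fun l _ ↦ ?_
      simp [Fin.succ_ne_zero]
    · rw [Finset.sum_eq_single (k.pred hk)]
      · simp
      · intro l _ hl
        have : l.succ ≠ k := fun h ↦ hl (by subst h; simp)
        simp [Ne.symm this]
      · intro h; exact absurd (Finset.mem_univ _) h
  have hdet : DL.det = 1 := by
    have htri : DL.BlockTriangular id := by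
      intro i k hik
      simp only [id] at hik
      simp only [hDL, Matrix.of_apply, subL]
      have hi0 : i ≠ 0 := by
        intro h; rw [h] at hik; exact (Fin.not_lt_zero k) hik
      rw [if_neg hi0, pderiv_X]
      simp [(ne_of_lt hik)]
    rw [Matrix.det_of_upperTriangular htri]
    refine Finset.prod_eq_one fun i _ ↦ ?_
    simp only [hDL, Matrix.of_apply, subL]
    split_ifs with hi
    · subst hi
      rw [map_sub, pderiv_X, hpt]
      simp
    · rw [pderiv_X]; simp
  rw [hprod, Matrix.det_mul, hdet, mul_one, ← AlgHom.map_det]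

end Subst

/-! ## The theorem -/

/-- **Wooley's theorem on simultaneous congruences** (Ford 2002, Lemma 2.4). Let
`F₁,…,F_d ∈ ℤ[x₁,…,x_d]`, `p` prime, `s ≥ 1`, and let `S` be a set of integer vectors that solve
`Fⱼ ≡ 0 (mod pˢ)` for all `j`, have Jacobian determinant prime to `p`, and are pairwise
incongruent modulo `pˢ`. Then `#S ≤ ∏ⱼ deg Fⱼ`. [cite: Wooley1996, Theorem 1] -/
theorem card_solutions_le {d : ℕ} (F : Fin d → MvPolynomial (Fin d) ℤ) {s : ℕ} (hs : 1 ≤ s)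
    (S : Finset (Fin d → ℤ))
    (hsol : ∀ x ∈ S, ∀ j, (p : ℤ) ^ s ∣ eval x (F j))
    (hjac : ∀ x ∈ S, ¬ (p : ℤ) ∣ eval x (jacPoly F).det)
    (hinc : ∀ x ∈ S, ∀ y ∈ S, (∀ i, (p : ℤ) ^ s ∣ x i - y i) → x = y) :
    S.card ≤ ∏ j, (F j).totalDegree := by
  classical
  -- `d = 0`
  rcases Nat.eq_zero_or_pos d with rfl | hdpos
  · rw [Finset.univ_eq_empty, Finset.prod_empty]
    exact Finset.card_le_one.2 fun x _ y _ ↦ funext fun i ↦ Fin.elim0 i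
  obtain ⟨n, rfl⟩ : ∃ n, d = n + 1 := ⟨d - 1, by omega⟩
  -- a constant `Fⱼ` forces `S = ∅`
  by_cases hdeg : ∃ j, (F j).totalDegree = 0
  · obtain ⟨j, hj⟩ := hdeg
    have hdet : (jacPoly F).det = 0 := by
      refine Matrix.det_eq_zero_of_row_eq_zero j fun i ↦ ?_
      simp only [jacPoly, Matrix.of_apply]
      rw [totalDegree_eq_zero_iff_eq_C] at hj
      rw [hj, pderiv_C]
    have : S = ∅ := Finset.eq_empty_of_forall_notMem fun x hx ↦ hjac x hx (by rw [hdet]; simp)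
    rw [this]; simp
  push Not at hdeg
  have hK1 : ∀ j, 1 ≤ (F j).totalDegree := fun j ↦ Nat.one_le_iff_ne_zero.2 (hdeg j)
  rcases S.eq_empty_or_nonempty with rfl | hSne
  · simp
  -- ideals
  set I : ℕ → Ideal ℤ_[p] := fun m ↦ Ideal.span {(p : ℤ_[p]) ^ m} with hI
  -- Step 1: Hensel lifts of the solutions
  set ax : S → (Fin (n + 1) → ℤ_[p]) := fun x i ↦ (x.1 i : ℤ_[p]) with hax
  have hFa : ∀ x : S, ∀ j, FEval F (ax x) j ∈ I s := by
    intro x j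
    simp only [FEval, hax, aeval_intCast, hI]
    exact intCast_mem_span_pow_iff.2 (hsol x.1 x.2 j)
  have hJa : ∀ x : S, IsUnit (Jac F (ax x)).det := by
    intro x
    rw [det_Jac_eq, hax, aeval_intCast]
    exact isUnit_intCast_of_not_dvd (hjac x.1 x.2)
  have hens := fun x : S ↦ hensel_mv F (ax x) hs (hFa x) (hJa x)
  choose bx hbx using fun x : S ↦ (hens x).exists
  have hbuniq : ∀ x : S, ∀ b, (∀ j, FEval F b j = 0) → (∀ i, b i - ax x i ∈ I s) → b = bx x :=
    fun x b h1 h2 ↦ (hens x).unique ⟨h1, h2⟩ (hbx x)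
  -- the lifts are injective
  have binj : Function.Injective bx := by
    intro x y hxy
    apply Subtype.ext
    refine hinc x.1 x.2 y.1 y.2 fun i ↦ ?_
    rw [← intCast_mem_span_pow_iff (p := p), Int.cast_sub]
    have h1 := (hbx x).2 i
    have h2 := (hbx y).2 i
    rw [hxy] at h1
    have := (I s).sub_mem h2 h1
    have e : bx y i - ax y i - (bx y i - ax x i) = ax x i - ax y i := by ring
    rw [e] at this
    simpa [hax, hI] using this
  -- the lifts are nonsingular
  have hJb : ∀ x : S, IsUnit (Jac F (bx x)).det := by
    intro x
    refine isUnit_of_sub_mem_span (hJa x) hs ?_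
    rw [det_Jac_eq, det_Jac_eq]
    exact aeval_sub_aeval_mem_span_pow _ _ _ s (hbx x).2
  -- Step 2: the separation exponent
  set U : ℕ := 1 + S.attach.sup fun x ↦ S.attach.sup fun y ↦
    Finset.univ.sup fun i ↦ PadicInt.valuation (bx x i - bx y i) with hU
  have hU1 : 1 ≤ U := by omega
  have hsepb : ∀ x y : S, ∀ i, bx x i = bx y i ∨ bx x i - bx y i ∉ I U := by
    intro x y i
    by_cases h : bx x i = bx y i
    · exact Or.inl h
    · refine Or.inr fun hmem ↦ ?_
      have hne : bx x i - bx y i ≠ 0 := sub_ne_zero.2 h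
      have hval := (PadicInt.mem_span_pow_iff_le_valuation _ hne U).1 hmem
      have hle : PadicInt.valuation (bx x i - bx y i) ≤ U - 1 := by
        have h1 : PadicInt.valuation (bx x i - bx y i)
            ≤ Finset.univ.sup fun i ↦ PadicInt.valuation (bx x i - bx y i) :=
          Finset.le_sup (f := fun i ↦ PadicInt.valuation (bx x i - bx y i)) (Finset.mem_univ i)
        have h2 : (Finset.univ.sup fun i ↦ PadicInt.valuation (bx x i - bx y i))
            ≤ S.attach.sup fun y ↦ Finset.univ.sup fun i ↦ PadicInt.valuation (bx x i - bx y i) :=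
          Finset.le_sup (f := fun y ↦ Finset.univ.sup fun i ↦ PadicInt.valuation (bx x i - bx y i))
            (Finset.mem_attach _ y)
        have h3 : (S.attach.sup fun y ↦ Finset.univ.sup fun i ↦ PadicInt.valuation (bx x i - bx y i))
            ≤ S.attach.sup fun x ↦ S.attach.sup fun y ↦
              Finset.univ.sup fun i ↦ PadicInt.valuation (bx x i - bx y i) :=
          Finset.le_sup (f := fun x ↦ S.attach.sup fun y ↦
            Finset.univ.sup fun i ↦ PadicInt.valuation (bx x i - bx y i)) (Finset.mem_attach _ x)
        omega
      omega
  -- Step 3: the transformed system `H = F ∘ L`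
  set L : Fin (n + 1) → MvPolynomial (Fin (n + 1)) ℤ := subL p U with hL
  set H : Fin (n + 1) → MvPolynomial (Fin (n + 1)) ℤ := fun j ↦ bind₁ L (F j) with hH
  have hHeval : ∀ (z : Fin (n + 1) → ℤ_[p]) j, FEval H z j = FEval F (vmap U z) j := by
    intro z j
    simp only [FEval, hH, aeval_bind₁, hL, aeval_subL]
  have hHjac : ∀ z : Fin (n + 1) → ℤ_[p], (Jac H z).det = aeval (vmap U z) (jacPoly F).det := by
    intro z
    rw [det_Jac_eq]
    change aeval z (jacPoly fun j ↦ bind₁ (subL p U) (F j)).det = _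
    rw [det_jacPoly_bind₁_subL, aeval_bind₁]
    have e : (fun i ↦ aeval z (subL (n := n) p U i)) = vmap U z := funext fun i ↦ aeval_subL U z i
    rw [e]
  set cx : S → (Fin (n + 1) → ℤ_[p]) := fun x ↦ vinv U (bx x) with hcx
  have hcx0 : ∀ x : S, ∀ j, FEval H (cx x) j = 0 := by
    intro x j; rw [hHeval, hcx, vmap_vinv]; exact (hbx x).1 j
  have hcxJ : ∀ x : S, IsUnit (Jac H (cx x)).det := by
    intro x; rw [hHjac, hcx, vmap_vinv, ← det_Jac_eq]; exact hJb x
  have hcxT : ∀ x : S, cx x 0 = tsep U (bx x) := fun x ↦ vinv_zero U (bx x)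
  -- Step 4: the eliminant of `H` (over `ℚ`)
  obtain ⟨x₀, hx₀⟩ := hSne
  set castℚ : ℤ →+* ℚ := Int.castRingHom ℚ with hcastℚ
  set Hℚ : Fin (n + 1) → MvPolynomial (Fin (n + 1)) ℚ := fun j ↦ map castℚ (H j) with hHℚ
  have hKH : ∀ j, (H j).totalDegree ≤ (F j).totalDegree := fun j ↦
    totalDegree_bind₁_le (subL (n := n) p U) (F j) (totalDegree_subL_le U)
  have hKℚ : ∀ j, (Hℚ j).totalDegree ≤ (F j).totalDegree := fun j ↦ by
    refine le_trans ?_ (hKH j)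
    simp only [hHℚ, MvPolynomial.totalDegree]
    exact Finset.sup_mono (support_map_subset castℚ (H j))
  have hdetH : (jacPoly H).det ≠ 0 := by
    intro h0
    have := hcxJ ⟨x₀, hx₀⟩
    rw [det_Jac_eq, h0, map_zero] at this
    exact not_isUnit_zero this
  have hJℚ : (Matrix.of fun j i ↦ pderiv i (Hℚ j)).det ≠ 0 := by
    have e : (Matrix.of fun j i ↦ pderiv i (Hℚ j)) = (MvPolynomial.map castℚ).mapMatrix (jacPoly H) := by
      ext j i
      simp [hHℚ, jacPoly, pderiv_map]
    rw [e, ← RingHom.map_det]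
    intro h0
    exact hdetH (map_injective _ Int.cast_injective (by rw [h0, map_zero]))
  obtain ⟨Ψ, hΨ0, hΨpos, hΨle, hΨrel⟩ :=
    exists_eliminant (Nat.succ_le_succ (Nat.zero_le n)) Hℚ (fun j ↦ (F j).totalDegree) hKℚ hK1 0 hJℚ
  -- Step 5: the leading coefficient in `y₀` and a lattice point avoiding it
  set P : Polynomial (MvPolynomial (Fin (n + 1)) ℚ) := finSuccEquiv ℚ (n + 1) Ψ with hP
  have hPne : P ≠ 0 := fun h ↦ hΨ0 ((finSuccEquiv ℚ (n + 1)).injective (by rw [← hP, h, map_zero]))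
  have hPdeg : P.natDegree = degreeOf 0 Ψ := natDegree_finSuccEquiv Ψ
  set D₀ : ℕ := P.natDegree with hD₀
  have hlead : P.coeff D₀ ≠ 0 := Polynomial.leadingCoeff_ne_zero.2 hPne
  set N : ℤ := (p : ℤ) ^ (2 * (n + 1) * U) with hN
  have hN0 : N ≠ 0 := pow_ne_zero _ (by exact_mod_cast (Fact.out : p.Prime).ne_zero)
  obtain ⟨α, hα⟩ := exists_lattice_eval_ne_zero (P.coeff D₀) hlead N hN0
  -- Step 6: Hensel lifts for the deformed system `H - N α`
  set H' : Fin (n + 1) → MvPolynomial (Fin (n + 1)) ℤ := fun j ↦ H j - C (N * α j) with hH'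
  have hH'eval : ∀ (z : Fin (n + 1) → ℤ_[p]) j, FEval H' z j = FEval H z j - (N * α j : ℤ) := by
    intro z j; simp [FEval, hH']
  have hH'jac : ∀ z : Fin (n + 1) → ℤ_[p], Jac H' z = Jac H z := by
    intro z; ext j i; simp [Jac, hH']
  have h2nU : 1 ≤ 2 * (n + 1) * U := by nlinarith
  have hens' : ∀ x : S, ∃! w : Fin (n + 1) → ℤ_[p], (∀ j, FEval H' w j = 0) ∧
      ∀ i, w i - cx x i ∈ I (2 * (n + 1) * U) := by
    intro x
    refine hensel_mv H' (cx x) h2nU (fun j ↦ ?_) (by rw [hH'jac]; exact hcxJ x)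
    rw [hH'eval, hcx0, zero_sub]
    refine (Ideal.neg_mem_iff _).2 (intCast_mem_span_pow_iff.2 ?_)
    rw [hN]; exact dvd_mul_right _ _
  choose wx hwx using fun x : S ↦ (hens' x).exists
  have hwH : ∀ x : S, ∀ j, aeval (wx x) (H j) = ((N * α j : ℤ) : ℤ_[p]) := by
    intro x j
    have := (hwx x).1 j
    rw [hH'eval] at this
    simpa [FEval, sub_eq_zero] using this
  -- Step 7: the first coordinates of the `wx` are pairwise distinct
  have hw_inj : ∀ x y : S, wx x 0 = wx y 0 → x = y := by
    intro x y hxy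
    by_contra hne
    have hbne : bx x ≠ bx y := fun h ↦ hne (binj h)
    have hT : tsep U (bx x) - tsep U (bx y) ∉ I (2 * (n + 1) * U) := fun hmem ↦
      hbne (tsep_separates U (bx x) (bx y) (hsepb x y) hmem)
    apply hT
    have h1 := (hwx x).2 0
    have h2 := (hwx y).2 0
    rw [hcxT] at h1 h2
    have := (I _).sub_mem h2 h1
    rw [hxy] at this
    have e : wx y 0 - tsep U (bx y) - (wx y 0 - tsep U (bx x)) = tsep U (bx x) - tsep U (bx y) := by ring
    rwa [e] at this
  -- Step 8: all `wx x 0` are roots of one nonzero polynomial of degree `≤ ∏ deg Fⱼ` over `ℚ_p`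
  set ι : ℤ_[p] →+* ℚ_[p] := PadicInt.Coe.ringHom with hι
  have hιinj : Function.Injective ι := Subtype.val_injective
  set φ : ℚ →+* ℚ_[p] := algebraMap ℚ ℚ_[p] with hφ
  set β : Fin (n + 1) → ℚ := fun i ↦ ((N * α i : ℤ) : ℚ) with hβ
  set γ : Fin (n + 1) → ℚ_[p] := fun i ↦ ((N * α i : ℤ) : ℚ_[p]) with hγ
  have hγβ : γ = fun i ↦ φ (β i) := by funext i; simp [hγ, hβ, hφ]
  set Ψp : MvPolynomial (Fin (n + 1 + 1)) ℚ_[p] := map φ Ψ with hΨp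
  set Q : Polynomial ℚ_[p] := Polynomial.map (eval γ) (finSuccEquiv ℚ_[p] (n + 1) Ψp) with hQ
  -- coefficients of `Q`
  have hQcoeff : ∀ i, Q.coeff i = φ (eval β (P.coeff i)) := by
    intro i
    rw [hQ, Polynomial.coeff_map]
    have e : (finSuccEquiv ℚ_[p] (n + 1) Ψp).coeff i = map φ (P.coeff i) := by
      ext m
      rw [finSuccEquiv_coeff_coeff, hΨp, coeff_map, coeff_map, hP, finSuccEquiv_coeff_coeff]
    rw [e, hγβ, eval_map_comp]
  have hQne : Q ≠ 0 := by
    intro h0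
    have := hQcoeff D₀
    rw [h0, Polynomial.coeff_zero] at this
    exact hα (φ.injective (by rw [← this, map_zero]))
  have hQdeg : Q.natDegree ≤ ∏ j, (F j).totalDegree := by
    refine le_trans ?_ (hPdeg ▸ hΨle)
    rw [Polynomial.natDegree_le_iff_coeff_eq_zero]
    intro i hi
    rw [hQcoeff, Polynomial.coeff_eq_zero_of_natDegree_lt (by exact_mod_cast hi), map_zero, map_zero]
  -- the roots
  have hroot : ∀ x : S, Q.IsRoot (ι (wx x 0)) := by
    intro x
    rw [Polynomial.IsRoot, hQ, ← eval_eq_eval_mv_eval', hΨp, MvPolynomial.eval_map,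
      ← MvPolynomial.aeval_def]
    -- evaluate the relation `bind₁ (cons (X 0) Hℚ) Ψ = 0` at `ι ∘ wx x`
    have hrel := congrArg (aeval fun i ↦ ι (wx x i)) hΨrel
    rw [map_zero, aeval_bind₁] at hrel
    have e : (fun t ↦ aeval (fun i ↦ ι (wx x i)) ((Fin.cons (X 0) Hℚ : Fin (n + 1 + 1) → MvPolynomial (Fin (n + 1)) ℚ) t))
        = Fin.cons (ι (wx x 0)) γ := by
      funext t
      refine Fin.cases ?_ (fun j ↦ ?_) t
      · simp
      · simp only [Fin.cons_succ, hHℚ]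
        rw [hcastℚ, show Int.castRingHom ℚ = algebraMap ℤ ℚ from rfl, aeval_map_algebraMap,
          ← ringHom_aeval ι (wx x) (H j), hwH]
        simp [hγ, hι]
    rw [e] at hrel
    exact hrel
  -- count
  have hcard : S.attach.card ≤ Q.roots.toFinset.card := by
    refine Finset.card_le_card_of_injOn (fun x ↦ ι (wx x 0)) (fun x _ ↦ ?_) (fun x _ y _ h ↦ ?_)
    · rw [Finset.mem_coe, Multiset.mem_toFinset, Polynomial.mem_roots hQne]
      exact hroot x
    · exact hw_inj x y (hιinj h)
  rw [Finset.card_attach] at hcard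
  exact hcard.trans ((Multiset.toFinset_card_le _).trans ((Polynomial.card_roots' Q).trans hQdeg))

end Wooley
end Literature.NumberTheory.LFunctions
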